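import Summits.ABC.IUTFork.Conditional.AbcOfSHwBadMReyssatApex
import Summits.ABC.IUTFork.Conditional.FreyLegendreP6Reyssat
import Summits.ABC.IUTFork.Conditional.AbcOfSHwindowFreyRefutationPrelims
import Summits.ABC.IUTFork.Conditional.AbcOfSGenuineKChosenDepthRadRows1
import Summits.ABC.IUTFork.Conditional.NotHSHwCompose
import HarnessLib

/-!
# Branch C, K line — the REYSSAT datum `(ratPoint (2/23⁵), 13)` is K-SHALLOW (degree form) at every genuine Θ-volume datum: a SECOND refuting datum
# for the K window binders `hSHwBad` (p453137) / `hSHw` (p447945) (whose refutations as PROPOSITIONS are already p477209), K twin of this seat's M apex p483704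

C scoreboard (abc-iut-C-cert-3 gen 4, INTAKE / CERTS pen; row «C:M-WINDOW-REYSSAT» sequel, K side). PROOF-ONLY (no `def`, no new `Prop`, no instance, no notation; nothing re-typed). The apex compositions use, all THEOREMS: abc-iut-W-neg-2's datum-agnostic compositions `not_hSHwBad_of_not_pilotKummerCompatHull`
/ `not_hSHw_of_not_pilotKummerCompatHull` (p463028, `NotHSHwCompose`); admissibility AS TYPED + the Szpiro-bad guard + non-emptiness = THIS SEAT's
`ReyssatM.mem_UP / admitsCore / condP2 / condP5 / szpiroBad / nonempty_thetaVolumeDatumAt` (p483052); (P6) = abc-iut-w6-d102's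
`FreyP6Reyssat.condP6_thirteen` (p482354); the per-datum K-line refutation = abc-iut-w5-d236's UNCONDITIONAL RAD row
`GenuineK.not_pilotKummerCompatHull_chosen_reyssat_thirteen` (`AbcOfSGenuineKChosenDepthRadRows1`, p466042); and the ONE new piece (§1 here):
K-SHALLOWNESS of every genuine datum in the DEGREE form of the K window binder — `ReyssatK.thirteen_le_finrank` (at the bad place over `23`, pole
order `10`, `13 ∣ e ≤ [K:ℚ]` — abc-iut-c312-7's `GenuineK.exists_bad_tame_place_of_ord_neg` + abc-iut-w6-d102's `GenuineK.le_finrank_of_bad_place_ratPoint`)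
and `ReyssatK.not_deep` (abc-iut-w6-d102's `GenuineK.not_degreeDeep_ratPoint` with `m = 10`, `m₃ = 20`: `10·10 ≤ 16·13`, `20·10 ≤ 24·13`).

READING (numbers, no side): at the Reyssat datum the K window clause S_H AS TYPED fails at every genuine datum (RAD over 23) while every datum is
K-SHALLOW (degree form) — and, by p482049/p483704, the M window clause fails too while every member is M-shallow: Reyssat @ 13 is the FIRST known
(datum, l) where BOTH window binders (K p453137 and M p453767) are refuted AS TYPED with no hypothesis. The θ-content records (K p460293, M p461893)
are untouched (no known triple is a content datum); no height bound follows; refuted-as-typed ≠ refuted-in-print (OUR sharp reading, per-label licence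
STRONGER than print's (xi-f)); (P6) is classical arithmetic of one curve over `ℚ`; nothing asserts that abc is proved or refuted, or takes a side on
any author (Mochizuki / Scholze–Stix / Joshi / Dupuy–Hilado); typed ≠ proved; instantiated ≠ endorsed.
[cite: Mochizuki2012, IUTchI Def. 3.1 (c) p. 62, Ex. 3.2 (iv) p. 71; IUTchIII Cor. 3.12 Step (xi-f) p. 184; IUTchIV Prop. 1.2 p. 10, Thm. 1.10 p. 22–23,
Cor. 2.2 (ii) proof (P2)(P5)(P6)(P7) p. 45–46] [claim: Mochizuki2012, status: disputed] for every IUT sentence quoted.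
-/

noncomputable section

open Set Function NumberField IsDedekindDomain

namespace Summit.ABC.IUTFork.Conditional

open Thm311 Thm311.Real Cor312 Cor312Vol Cor312Prov Literature.IUT.LogThetaLattice Literature.IUT.LogVolume
  Literature.IUT.HodgeTheaters Literature.IUT.LogVolume.ThetaData Literature.IUT.LogVolume.Cor22
open Literature.NumberTheory.NumberFields Literature.NumberTheory.DiophantineGeometry
  Literature.NumberTheory.DiophantineGeometry.GenEll Literature.NumberTheory.DiophantineGeometry.UniformABCConjecture
  Rat.HeightOneSpectrum Summit.ABC.ABC.Theorems

/-! ## §1. Every genuine Θ-volume datum over `(ratPoint (2/23⁵), 13)` is OFF the degree-form depth locus -/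

/-- Pole-order bound away from `3`: `−10 ≤ ord_v j(2/23⁵)` (worst: `p = 23`, `h = 10`). [folklore] -/
theorem ReyssatK.ord_jInv_ge_of_ne_three (v : HeightOneSpectrum (𝓞 ℚ)) (h3 : natGenerator v ≠ 3) :
    -((10 : ℕ) : ℤ) ≤ ord ℚ v (Cor22.jInv (((2 : ℕ) : ℚ) / (23 ^ 5 : ℕ))) := by
  by_cases hv : natGenerator v ∈ ({3, 23, 109} : Finset ℕ)
  · rw [ReyssatM.ord_jInv_of_mem v hv]
    simp only [Finset.mem_insert, Finset.mem_singleton] at hv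
    rcases hv with h | h | h
    · exact absurd h h3
    · rw [h]; norm_num
    · rw [h]; norm_num
  · have := ReyssatM.ord_jInv_nonneg_of_not_mem v hv
    omega

/-- Pole-order bound at `3`: `−20 ≤ ord_v j(2/23⁵)`. [folklore] -/
theorem ReyssatK.ord_jInv_ge_of_three (v : HeightOneSpectrum (𝓞 ℚ)) (h3 : natGenerator v = 3) :
    -((20 : ℕ) : ℤ) ≤ ord ℚ v (Cor22.jInv (((2 : ℕ) : ℚ) / (23 ^ 5 : ℕ))) := by
  rw [ReyssatM.ord_jInv_of_mem v (by rw [h3]; simp), h3]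
  norm_num

/-- **`13 ≤ [K:ℚ]` for EVERY genuine Θ-volume datum over `(ratPoint (2/23⁵), 13)`**: at the bad place over `23` (pole order `10`, prime to `13`) the
chosen q-idele forces `13 ∣ e(x₀|23) ≤ [K:ℚ]` (pattern of abc-iut-w6-d102's `FreyTier1.thirteen_le_finrank`). [cite: Mochizuki2012, IUTchI Def. 3.1 (c) p. 62,
Ex. 3.2 (iv) p. 71] [claim: Mochizuki2012, status: disputed] -/
theorem ReyssatK.thirteen_le_finrank (T : Cor22.ThetaVolumeDatumAt (ratPoint (((2 : ℕ) : ℚ) / (23 ^ 5 : ℕ))) 13) :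
    letI := T.instFieldF; letI := T.instNumberFieldF; letI := T.instAlgebraF; letI := T.instFieldK
    letI := T.instNumberFieldK; letI := T.instAlgebraK; letI := T.instFieldFbar; letI := T.instAlgebraFbar
    letI := T.instAlgebraKFbar; letI := T.instIsElliptic
    13 ≤ Module.finrank ℚ T.K := by
  letI := T.instFieldF; letI := T.instNumberFieldF; letI := T.instAlgebraF; letI := T.instFieldK
  letI := T.instNumberFieldK; letI := T.instAlgebraK; letI := T.instFieldFbar; letI := T.instAlgebraFbar
  letI := T.instAlgebraKFbar; letI := T.instIsElliptic
  set v₀ : HeightOneSpectrum (𝓞 ℚ) := (primesEquiv (R := 𝓞 ℚ)).symm ⟨23, by norm_num⟩ with hv₀def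
  have hgen : natGenerator v₀ = 23 := congrArg Subtype.val ((primesEquiv (R := 𝓞 ℚ)).apply_symm_apply ⟨23, by norm_num⟩)
  have hv₀ : ((23 : ℕ) : 𝓞 ℚ) ∈ v₀.asIdeal := by rw [natCast_mem_asIdeal_iff, hgen]
  have hram : ramIdx ℚ v₀ = 1 := by
    have h1 := ramificationIdx_int_le_finrank_rat (F₀ := ℚ) v₀
    rw [Module.finrank_self, ← ramIdx_eq] at h1
    have h2 : ramIdx ℚ v₀ ≠ 0 := ramIdx_ne_zero ℚ v₀
    omega
  have hv₀e : ¬ (23 : ℕ) ∣ ramIdx ℚ v₀ := by rw [hram]; norm_num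
  have hm : ord ℚ v₀ (jInv (((2 : ℕ) : ℚ) / (23 ^ 5 : ℕ))) = -((10 : ℕ) : ℤ) := by
    rw [ReyssatM.ord_jInv_of_mem v₀ (by rw [hgen]; simp), hgen]; norm_num
  obtain ⟨x₀, hS, -, -, -⟩ := GenuineK.exists_bad_tame_place_of_ord_neg T ReyssatM.mem_UP (by norm_num) ⟨23, by norm_num⟩
    (by norm_num) (by norm_num) (by norm_num) (by norm_num) v₀ hv₀ hv₀e hm (by norm_num)
  haveI : Fact (Nat.Prime 23) := ⟨by norm_num⟩
  set v₁ : HeightOneSpectrum (𝓞 ℚ) :=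
    Literature.IUT.LogVolume.finBelow (ratPoint (((2 : ℕ) : ℚ) / (23 ^ 5 : ℕ))).F T.F
      (Literature.IUT.LogVolume.finBelow T.F T.K (placeOf (pilotDataOfK T.D T.K) 23 x₀)) with hv₁def
  have hgen₁ : natGenerator v₁ = 23 := GenuineK.natGenerator_eq_of_eq_finBelow_placeOf T ⟨23, by norm_num⟩ x₀ v₁ hv₁def
  have hnd : ¬ ((13 : ℤ) ∣ ord ℚ v₁ (jInv (((2 : ℕ) : ℚ) / (23 ^ 5 : ℕ)))) := by
    rw [ReyssatM.ord_jInv_of_mem v₁ (by rw [hgen₁]; simp), hgen₁]; norm_num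
  exact (GenuineK.le_finrank_of_bad_place_ratPoint T (by norm_num) ⟨23, by norm_num⟩ x₀ v₁ hv₁def hS hnd).2

/-- **EVERY genuine Θ-volume datum over `(ratPoint (2/23⁵), 13)` is OFF the degree-form depth locus** — the antecedent of `hSHwBad` VERBATIM
(`GenuineK.not_degreeDeep_ratPoint` with `m = 10`, `m₃ = 20`, `3 ≤ 13 ≤ [K:ℚ]`). [cite: Mochizuki2012, IUTchIV Prop. 1.2 p. 10, Cor. 2.2 (P2) p. 45]
[claim: Mochizuki2012, status: disputed] -/
theorem ReyssatK.not_deep (T : Cor22.ThetaVolumeDatumAt (ratPoint (((2 : ℕ) : ℚ) / (23 ^ 5 : ℕ))) 13) :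
    letI := T.instFieldF; letI := T.instNumberFieldF; letI := T.instAlgebraF; letI := T.instFieldK
    letI := T.instNumberFieldK; letI := T.instAlgebraK; letI := T.instFieldFbar; letI := T.instAlgebraFbar
    letI := T.instAlgebraKFbar; letI := T.instIsElliptic
    ¬ (∃ (pp : Nat.Primes) (_ : 2 < (pp : ℕ)) (i : Fin (thetaIndex (pilotDataOfK T.D T.K)).lstar)
          (x₀ : (thetaIndex (pilotDataOfK T.D T.K)).Fibre (.inr pp)),
        haveI : Fact (pp : ℕ).Prime := ⟨pp.2⟩
        ((pp : ℕ) : ℝ) ^ ((((i : ℕ) : ℝ) + 2) * (4 + 2 * Real.logb (pp : ℕ) (Module.finrank ℚ T.K)) + 1) *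
          ‖(exists_realising_qIdeles_pilotDataOfK T.D).choose pp x₀‖ ^ (((i : ℕ) + 1) ^ 2 - 1) < 1) :=
  GenuineK.not_degreeDeep_ratPoint T (by norm_num) (by norm_num) 10 20 (by norm_num) (by norm_num)
    ReyssatK.ord_jInv_ge_of_ne_three ReyssatK.ord_jInv_ge_of_three (le_trans (by norm_num) (ReyssatK.thirteen_le_finrank T))

/-! ## §2. Why no apex theorem is filed here

The apices «`¬ hSHwBad` / `¬ hSHw` at the Reyssat datum» were built in this seat's folder (farm rc 0: W-neg-2's `not_hSHwBad_of_not_pilotKummerCompatHull`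
/ `not_hSHw_of_not_pilotKummerCompatHull` fed with `ReyssatM.mem_UP/…/szpiroBad`, `ReyssatK.not_deep`, abc-iut-w5-d236's
`GenuineK.not_pilotKummerCompatHull_chosen_reyssat_thirteen` and `FreyP6Reyssat.condP6_thirteen`) but are NOT filed: as PROPOSITIONS they coincide with
abc-iut-w6-d102's landed `not_hSHwBad_frey_holds` / `not_hSHw_frey_holds` (p477209) — the refuted `∀`-binders are datum-free statements, so a second
refuting datum proves the SAME theorem (gate `dedup.landed`; C-R66 (e)). What this file records is the per-datum fact: (Reyssat, 13) is a SECOND known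
(datum, l) at which every genuine datum is K-SHALLOW (degree form, §1) while the K licence fails (p466042) — i.e. a second refuting datum for the K window
binders, and (with p483704) the first where BOTH the K and the M window clauses fail at shallow data. -/

end Summit.ABC.IUTFork.Conditional

end
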